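import Mathlib
import HarnessLib

/-!
# The height zeta function of projective space over a number field converges for `s > n`

Topic `NumberTheory/DiophantineGeometry`; namespace `Literature.ProjectiveHeight`. Everything in this
file is **proved** (Mathlib only: the Weil height `NumberTheory.Height.*`, Dirichlet's unit
theorem `NumberField.Units.unitLattice`, the class group `ClassGroup (𝓞 K)`, and the lattice sums
`ZLattice.summable_norm_rpow`).

For a number field `K` of degree `d` and an index type `ι` with `n = #ι ≥ 1`, let
`H_K(ξ) = ∏_v max_i |x_i|_v^{[K_v : ℚ_v]}` be the *relative* multiplicative Weil height of
`ξ = (x_i)_i ∈ ℙ(K^ι) = ℙ^{n-1}(K)` (Mathlib `Projectivization.mulHeight`; Bombieri–Gubler 1.5.4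
use the absolute height `H = H_K^{1/d}`). Schanuel's theorem (Schanuel 1979; Bombieri–Gubler
11.10.5) is the asymptotic `#{ξ : H_K(ξ) ≤ B} = c_{K,n} Bⁿ + O(B^{n-1/d} (log B))`, so that the
*height zeta function* `Z(s) = ∑_{ξ ∈ ℙ^{n-1}(K)} H_K(ξ)^{-s}` converges exactly for `s > n`. This
file proves the convergence:

* `summable_mulHeight_rpow_neg` — `∑_{ξ ∈ ℙ(K^ι)} H_K(ξ)^{-s} < ∞` for every real `s > #ι`;
* `finite_setOf_mulHeight_le` — **Northcott's theorem** for `ℙ^{n-1}(K)`: finitely many points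
  of bounded height (Northcott 1949; Bombieri–Gubler, Thm. 2.4.9; a `TODO` of Mathlib's
  `NumberTheory.Height.Northcott`, which has the case of `ℙ¹`/field elements).

## Proof (Schanuel's reduction to a lattice-point count, in its crudest form)

1. `exists_integral_rep_absNorm_le` — every `0 ≠ x ∈ K^ι` is proportional to an integral vector
   `y₀` whose content ideal `⟨y₀⟩` is the chosen integral representative of its ideal class, so
   `N⟨y₀⟩ ≤ C_K` (finiteness of the class group); then `H_K(x) = H_∞(y₀) / N⟨y₀⟩ ≥ H_∞(y₀)/C_K`
   (`mulHeight_mul_absNorm_eq_archHeight`, from Mathlib's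
   `NumberField.absNorm_mul_finprod_finitePlace_eq_one`), where
   `H_∞(y) = ∏_{w ∣ ∞} max_i w(y_i)^{m_w}` (`archHeight`).
2. `exists_unit_mul_le` — **balancing by units**: for positive reals `(a_w)_{w ∣ ∞}` there is a
   unit `u` with `w(u) a_w ≤ C_K (∏ a_w^{m_w})^{1/d}` for all `w` (the log-embedding of `𝓞 Kˣ` is
   a full lattice in the trace-zero hyperplane, with a bounded fundamental domain). Hence
   (`exists_integral_rep_archSup_pow_le`) the representative `y = u y₀` has sup-norm
   `‖y‖_∞^d ≤ C_K H_K(x)` under the Minkowski embedding.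
3. `ξ ↦ y_ξ` is injective and `H_K(ξ)^{-s} ≤ C ∏_i max(1, ‖σ(y_{ξ,i})‖)^{-ds/n}`; the right side is
   summable over all of `(𝓞 K)^ι` (`summable_pi_prod`) because `∑_{z ∈ 𝓞 K} max(1,‖σ z‖)^{-r}`
   converges for `r = ds/n > d = rank 𝓞 K` (`summable_max_one_norm_rpow_neg`, from
   `ZLattice.summable_norm_rpow` for the lattice `σ(𝓞 K) ⊆ K ⊗ ℝ`).

## Purpose

Root input (F6 of the programme recorded in `SummableNormSqTraceSatakePow`) for the convergence on
`σ > 1` of the mirabolic Eisenstein series of `GL_n` over `K` in Epstein form,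
`E_σ(g) = |det g|_𝔸^σ ∑_{ξ ∈ ℙ^{n-1}(K)} ‖ξ g‖_𝔸^{-nσ}` — at `g = 1` the height zeta function at
`s = nσ > n` — the weight of the Rankin–Selberg integral of Jacquet–Shalika, *On Euler products and
the classification of automorphic representations I*, Amer. J. Math. 103 (1981), §4, behind the
named fact `Literature.NumberTheory.Automorphic.summable_normSq_trace_satakePow` ((5.3.3)–(5.3.4) of loc. cit.).

## References

* S. H. Schanuel, *Heights in number fields*, Bull. Soc. Math. France 107 (1979), 433–449
  [Schanuel1979].
* E. Bombieri, W. Gubler, *Heights in Diophantine Geometry*, CUP (2006): 1.5.4 (the Weil height on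
  `ℙⁿ`), Thm. 2.4.9 (Northcott's theorem), 11.10.5 (Schanuel's theorem) [BombieriGubler2006].
* D. G. Northcott, *An inequality in the theory of arithmetic on algebraic varieties*, Proc.
  Cambridge Philos. Soc. 45 (1949), 502–509 [Northcott1949].
-/

noncomputable section

open NumberField NumberField.InfinitePlace Module
open scoped Classical LinearAlgebra.Projectivization

namespace Literature.NumberTheory.DiophantineGeometry

namespace ProjectiveHeight

/-! ### Sums over finite product types and over the ring of integers -/

section Sums

/-- A product of copies of a non-negative summable family is summable over the finite product
type: `∑_{y : ι → β} ∏_i f(y_i) ≤ (∑_b f b)^{#ι}`. [folklore] -/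
theorem summable_pi_prod {β ι : Type*} [Fintype ι] {f : β → ℝ} (hf0 : 0 ≤ f)
    (hf : Summable f) : Summable fun y : ι → β => ∏ i, f (y i) := by
  classical
  refine summable_of_sum_le (c := (∑' b, f b) ^ Fintype.card ι)
    (fun y => Finset.prod_nonneg fun i _ => hf0 _) fun u => ?_
  calc ∑ y ∈ u, ∏ i, f (y i)
      ≤ ∑ y ∈ Fintype.piFinset (fun i => u.image (fun y : ι → β => y i)), ∏ i, f (y i) := by
        apply Finset.sum_le_sum_of_subset_of_nonneg
        · intro y hy
          exact Fintype.mem_piFinset.mpr fun i => Finset.mem_image_of_mem _ hy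
        · intro y _ _
          exact Finset.prod_nonneg fun i _ => hf0 _
    _ = ∏ i, ∑ b ∈ u.image (fun y : ι → β => y i), f b := (Finset.prod_univ_sum _ _).symm
    _ ≤ ∏ _i : ι, ∑' b, f b := by
        apply Finset.prod_le_prod
        · intro i _
          exact Finset.sum_nonneg fun b _ => hf0 b
        · intro i _
          exact hf.sum_le_tsum _ (fun b _ => hf0 b)
    _ = (∑' b, f b) ^ Fintype.card ι := by simp

variable (K : Type*) [Field K] [NumberField K]

/-- `∑_{z ∈ 𝓞 K} max(1, ‖z‖_∞)^{-r} < ∞` for `r > [K : ℚ]`, where `‖z‖_∞ = max_w w(z)` is the sup norm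
of the Minkowski embedding (Mathlib `mixedEmbedding`): the image of `𝓞 K` is a lattice of rank
`[K : ℚ]` in `K ⊗ ℝ` (Mathlib `mixedEmbedding.integerLattice`, `ZLattice.summable_norm_rpow`).
[folklore] -/
theorem summable_max_one_norm_rpow_neg {r : ℝ} (hr : (finrank ℚ K : ℝ) < r) :
    Summable fun z : 𝓞 K => (max 1 ‖mixedEmbedding K (z : K)‖) ^ (-r) := by
  classical
  set L := mixedEmbedding.integerLattice K with hL
  have hsum : Summable fun v : L => ‖(v : mixedEmbedding.mixedSpace K)‖ ^ (-r) := by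
    have h := ZLattice.summable_norm_rpow L (-r) (by
      rw [ZLattice.rank ℝ L, mixedEmbedding.finrank]
      exact neg_lt_neg hr)
    simpa using h
  -- the bijection `𝓞 K ≃ L`
  let e : 𝓞 K → L := fun z => ⟨mixedEmbedding K (z : K), LinearMap.mem_range.mpr ⟨z, rfl⟩⟩
  have he : Function.Bijective e := by
    constructor
    · intro z z' h
      have h' : mixedEmbedding K (z : K) = mixedEmbedding K (z' : K) := congrArg Subtype.val h
      exact RingOfIntegers.ext (mixedEmbedding_injective K h')
    · rintro ⟨v, hv⟩
      obtain ⟨z, rfl⟩ := LinearMap.mem_range.mp hv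
      exact ⟨z, rfl⟩
  have hsum' : Summable fun z : 𝓞 K => ‖mixedEmbedding K (z : K)‖ ^ (-r) :=
    (Equiv.ofBijective e he).summable_iff.mpr hsum
  refine Summable.of_norm_bounded_eventually hsum' ?_
  have hfin : ({0} : Set (𝓞 K))ᶜ ∈ Filter.cofinite := by
    simp
  filter_upwards [hfin] with z hz
  have hz0 : (z : K) ≠ 0 := by
    intro h
    exact hz (RingOfIntegers.ext (by simpa using h))
  have hpos : 0 < ‖mixedEmbedding K (z : K)‖ := by
    rw [norm_pos_iff]
    intro h
    exact hz0 (mixedEmbedding_injective K (by simpa using h))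
  rw [Real.norm_of_nonneg (Real.rpow_nonneg (by positivity) _)]
  exact Real.rpow_le_rpow_of_nonpos hpos (le_max_right _ _) (by linarith [hr, (Nat.cast_nonneg _ : (0:ℝ) ≤ finrank ℚ K)])

end Sums

/-! ### Archimedean size of a vector -/

section Arch

variable {K : Type*} [Field K] {ι : Type*}

/-- `A_w(x) = max_i w(x_i)`, the sup of the `w`-adic absolute values of the coordinates of
`x ∈ K^ι` at an infinite place `w` (the factor at `w` of the Weil height, Bombieri–Gubler 1.5.4).
[cite: BombieriGubler2006, 1.5.4] -/
def supAt (w : InfinitePlace K) (x : ι → K) : ℝ := ⨆ i, w (x i)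

/-- The archimedean sup norm `‖x‖_∞ = max_{w ∣ ∞} max_i w(x_i)` of `x ∈ K^ι`. [folklore] -/
def archSup (x : ι → K) : ℝ := ⨆ w : InfinitePlace K, supAt w x

/-- `A_w(x) ≥ 0`. [folklore] -/
theorem supAt_nonneg (w : InfinitePlace K) (x : ι → K) : 0 ≤ supAt w x :=
  Real.iSup_nonneg fun _ => apply_nonneg _ _

/-- `A_w(c x) = w(c) A_w(x)`. [folklore] -/
theorem supAt_smul (w : InfinitePlace K) (c : K) (x : ι → K) :
    supAt w (c • x) = w c * supAt w x := by
  simp only [supAt, Pi.smul_apply, smul_eq_mul, map_mul]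
  exact (Real.mul_iSup_of_nonneg (apply_nonneg _ _) _).symm

/-- `w(x_i) ≤ A_w(x)`. [folklore] -/
theorem le_supAt [Finite ι] (w : InfinitePlace K) (x : ι → K) (i : ι) : w (x i) ≤ supAt w x :=
  le_ciSup (f := fun i => (w (x i) : ℝ)) (Set.finite_range _).bddAbove i

/-- `A_w(x) > 0` for `x ≠ 0`. [folklore] -/
theorem supAt_pos [Finite ι] (w : InfinitePlace K) {x : ι → K} (hx : x ≠ 0) : 0 < supAt w x := by
  obtain ⟨i, hi⟩ := Function.ne_iff.mp hx
  exact ((InfinitePlace.pos_iff).mpr hi).trans_le (le_supAt w x i)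

/-- `‖x‖_∞ ≥ 0`. [folklore] -/
theorem archSup_nonneg (x : ι → K) : 0 ≤ archSup x :=
  Real.iSup_nonneg fun w => supAt_nonneg w x

/-- `‖x‖_∞ ≤ B` as soon as every `w(x_i) ≤ B` (`B ≥ 0`). [folklore] -/
theorem archSup_le {x : ι → K} {B : ℝ} (h : ∀ (w : InfinitePlace K) (i : ι), w (x i) ≤ B)
    (hB : 0 ≤ B) : archSup x ≤ B := by
  rcases isEmpty_or_nonempty ι with hι | hι
  · simp only [archSup, supAt, Real.iSup_of_isEmpty]
    rcases isEmpty_or_nonempty (InfinitePlace K) with hK | hK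
    · rw [Real.iSup_of_isEmpty]; exact hB
    · rw [ciSup_const]; exact hB
  · rcases isEmpty_or_nonempty (InfinitePlace K) with hK | hK
    · simp only [archSup, Real.iSup_of_isEmpty]; exact hB
    · exact ciSup_le fun w => ciSup_le fun i => h w i

variable [NumberField K]

/-- `A_w(x) ≤ ‖x‖_∞`. [folklore] -/
theorem supAt_le_archSup (w : InfinitePlace K) (x : ι → K) : supAt w x ≤ archSup x :=
  le_ciSup (f := fun w : InfinitePlace K => supAt w x) (Set.finite_range _).bddAbove w

/-- `w(x_i) ≤ ‖x‖_∞`. [folklore] -/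
theorem le_archSup [Finite ι] (w : InfinitePlace K) (x : ι → K) (i : ι) : w (x i) ≤ archSup x :=
  (le_supAt w x i).trans (supAt_le_archSup w x)

/-- The norm of the Minkowski embedding of a coordinate is at most `‖x‖_∞`:
`‖σ(x_i)‖ = max_w w(x_i) ≤ ‖x‖_∞`. [folklore] -/
theorem norm_mixedEmbedding_le_archSup [Finite ι] (x : ι → K) (i : ι) :
    ‖mixedEmbedding K (x i)‖ ≤ archSup x := by
  rw [mixedEmbedding.norm_eq_sup'_normAtPlace]
  exact Finset.sup'_le _ _ fun w _ => by
    rw [mixedEmbedding.normAtPlace_apply]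
    exact le_archSup w x i

/-- The **archimedean height** `H_∞(x) = ∏_{w ∣ ∞} max_i w(x_i)^{m_w}` of `x ∈ K^ι` (the
archimedean part of the relative multiplicative Weil height `H_K`; `m_w = 1, 2` for real, complex
`w`). [cite: BombieriGubler2006, 1.5.4–1.5.7] -/
def archHeight (x : ι → K) : ℝ := ∏ w : InfinitePlace K, supAt w x ^ w.mult

/-- `H_∞(x) ≥ 0`. [folklore] -/
theorem archHeight_nonneg (x : ι → K) : 0 ≤ archHeight x :=
  Finset.prod_nonneg fun w _ => pow_nonneg (supAt_nonneg w x) _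

/-- `H_∞(x) > 0` for `x ≠ 0`. [folklore] -/
theorem archHeight_pos [Finite ι] {x : ι → K} (hx : x ≠ 0) : 0 < archHeight x :=
  Finset.prod_pos fun w _ => pow_pos (supAt_pos w hx) _

/-- `H_∞(c x) = |N_{K/ℚ}(c)| H_∞(x)` (Mathlib `InfinitePlace.prod_eq_abs_norm`). [folklore] -/
theorem archHeight_smul (c : K) (x : ι → K) :
    archHeight (c • x) = |(Algebra.norm ℚ c : ℚ)| * archHeight x := by
  simp only [archHeight, supAt_smul, mul_pow, Finset.prod_mul_distrib, prod_eq_abs_norm]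

/-- `H_∞(x) ≤ ‖x‖_∞^{[K:ℚ]}`. [folklore] -/
theorem archHeight_le_archSup_pow (x : ι → K) : archHeight x ≤ archSup x ^ finrank ℚ K := by
  rw [archHeight, ← sum_mult_eq, ← Finset.prod_pow_eq_pow_sum]
  exact Finset.prod_le_prod (fun w _ => pow_nonneg (supAt_nonneg w x) _)
    fun w _ => pow_le_pow_left₀ (supAt_nonneg w x) (supAt_le_archSup w x) _

/-- **The finite part of the height of an integral vector.** For `0 ≠ y ∈ (𝓞 K)^ι`,
`H_K(y) · N(⟨y_1, …, y_n⟩) = H_∞(y)`: the non-archimedean part of the Weil height of an integral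
vector is the inverse norm of the ideal generated by its coordinates (Mathlib
`NumberField.absNorm_mul_finprod_finitePlace_eq_one`). [folklore] -/
theorem mulHeight_mul_absNorm_eq_archHeight [Finite ι] {y : ι → 𝓞 K} (hy : y ≠ 0) :
    Height.mulHeight (fun i => (y i : K)) * Ideal.absNorm (Ideal.span (Set.range y)) =
      archHeight (fun i => (y i : K)) := by
  have hy' : (fun i => (y i : K)) ≠ 0 := by
    obtain ⟨i, hi⟩ := Function.ne_iff.mp hy
    exact Function.ne_iff.mpr ⟨i, by simpa using hi⟩
  have h1 := NumberField.absNorm_mul_finprod_finitePlace_eq_one (K := K) hy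
  rw [NumberField.mulHeight_eq hy', archHeight]
  simp only [supAt]
  calc (∏ v : InfinitePlace K, (⨆ i, v (y i : K)) ^ v.mult) *
        (∏ᶠ v : FinitePlace K, ⨆ i, v (y i : K)) * (Ideal.absNorm (Ideal.span (Set.range y)) : ℝ)
      = (∏ v : InfinitePlace K, (⨆ i, v (y i : K)) ^ v.mult) *
        ((Ideal.absNorm (Ideal.span (Set.range y)) : ℝ) * ∏ᶠ v : FinitePlace K, ⨆ i, v (y i : K)) := by
        ring
    _ = _ := by rw [h1, mul_one]

/-- A non-zero algebraic integer vector has `‖y‖_∞ ≥ 1` (some coordinate has `|N(y_i)| ≥ 1`).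
[folklore] -/
theorem one_le_archSup [Finite ι] {y : ι → 𝓞 K} (hy : y ≠ 0) :
    1 ≤ archSup (fun i => (y i : K)) := by
  obtain ⟨i, hi⟩ := Function.ne_iff.mp hy
  by_contra h
  rw [not_le] at h
  have h0 : 0 ≤ archSup (fun i => (y i : K)) := archSup_nonneg _
  -- `∏_w w(y_i)^{m_w} = |N(y_i)| ≥ 1`, but each factor is `< 1`
  have hprod : ∏ w : InfinitePlace K, w (y i : K) ^ w.mult < 1 := by
    calc ∏ w : InfinitePlace K, w (y i : K) ^ w.mult
        ≤ ∏ w : InfinitePlace K, archSup (fun i => (y i : K)) ^ w.mult :=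
          Finset.prod_le_prod (fun w _ => pow_nonneg (apply_nonneg _ _) _)
            fun w _ => pow_le_pow_left₀ (apply_nonneg _ _) (le_archSup w (fun i => (y i : K)) i) _
      _ = archSup (fun i => (y i : K)) ^ finrank ℚ K := by
          rw [Finset.prod_pow_eq_pow_sum, sum_mult_eq]
      _ < 1 := pow_lt_one₀ h0 h Module.finrank_pos.ne'
  have hnorm : (1 : ℝ) ≤ ∏ w : InfinitePlace K, w (y i : K) ^ w.mult := by
    rw [prod_eq_abs_norm, ← Algebra.coe_norm_int]
    have hne : Algebra.norm ℤ (y i) ≠ 0 := Algebra.norm_ne_zero_iff.mpr hi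
    have : (1 : ℤ) ≤ |Algebra.norm ℤ (y i)| := Int.one_le_abs hne
    exact_mod_cast this
  linarith

end Arch

/-! ### Integral representatives with bounded content (finiteness of the class group) -/

section ClassGroup

variable (K : Type*) [Field K] [NumberField K] (ι : Type*) [Finite ι]

/-- **Clearing denominators within a fixed ideal class.** There is a constant `C = C_K ≥ 1` such
that every non-zero `x ∈ K^ι` has a scalar multiple `y = t x ∈ (𝓞 K)^ι`, `t ∈ Kˣ`, whose
coordinates generate an ideal of norm `N(⟨y_1, …, y_n⟩) ≤ C`: clear denominators, then move the
content ideal to the integral representative of its class (finiteness of the class group; Mathlib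
`ClassGroup.mk0_surjective`, `ClassGroup.mk0_eq_mk0_iff`, `Fintype (ClassGroup (𝓞 K))`). This is
the standard first step in counting points of `ℙ^{n-1}(K)` (Schanuel 1979). [folklore] -/
theorem exists_integral_rep_absNorm_le :
    ∃ C : ℝ, 1 ≤ C ∧ ∀ x : ι → K, x ≠ 0 → ∃ (t : K) (y : ι → 𝓞 K), t ≠ 0 ∧
      (∀ i, (y i : K) = t * x i) ∧ (Ideal.absNorm (Ideal.span (Set.range y)) : ℝ) ≤ C := by
  classical
  -- integral representatives of the ideal classes and a bound for their norms
  choose J hJ using (ClassGroup.mk0_surjective (R := 𝓞 K))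
  set Cn : ℕ := Finset.univ.sup fun c => Ideal.absNorm ((J c : nonZeroDivisors (Ideal (𝓞 K))) :
    Ideal (𝓞 K)) with hCn
  refine ⟨max 1 (Cn : ℝ), le_max_left _ _, fun x hx => ?_⟩
  -- clear denominators: `z = b • x` integral
  obtain ⟨b, hb⟩ := IsLocalization.exist_integer_multiples_of_finite (nonZeroDivisors (𝓞 K)) x
  have hz : ∀ i, ∃ z : 𝓞 K, (z : K) = (b : 𝓞 K) • x i := fun i => by
    obtain ⟨z, hz⟩ := RingHom.mem_rangeS.mp (hb i)
    exact ⟨z, hz⟩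
  choose z hz using hz
  have hb0 : ((b : 𝓞 K) : K) ≠ 0 := by
    have : (b : 𝓞 K) ≠ 0 := nonZeroDivisors.coe_ne_zero b
    exact_mod_cast this
  obtain ⟨i₀, hi₀⟩ := Function.ne_iff.mp hx
  have hzi₀ : z i₀ ≠ 0 := by
    intro h
    have : (z i₀ : K) = 0 := by simp [h]
    rw [hz i₀, Algebra.smul_def] at this
    exact mul_ne_zero hb0 hi₀ this
  -- the content ideal and its class
  set I₀ : Ideal (𝓞 K) := Ideal.span (Set.range z) with hI₀
  have hI₀0 : I₀ ≠ 0 := by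
    intro h
    apply hzi₀
    have : z i₀ ∈ I₀ := Ideal.subset_span ⟨i₀, rfl⟩
    rw [h] at this
    simpa using this
  let I₀' : nonZeroDivisors (Ideal (𝓞 K)) := ⟨I₀, mem_nonZeroDivisors_of_ne_zero hI₀0⟩
  set J₀ := J (ClassGroup.mk0 I₀') with hJ₀
  have hcl : ClassGroup.mk0 I₀' = ClassGroup.mk0 J₀ := (hJ (ClassGroup.mk0 I₀')).symm
  obtain ⟨a, c', ha, hc', hac⟩ := ClassGroup.mk0_eq_mk0_iff.mp hcl
  -- `a * z i = c' * y i` with `y i ∈ J₀`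
  have hy : ∀ i, ∃ y ∈ (J₀ : Ideal (𝓞 K)), c' * y = a * z i := fun i => by
    have h1 : a * z i ∈ Ideal.span {a} * I₀ :=
      Ideal.mul_mem_mul (Ideal.mem_span_singleton_self a) (Ideal.subset_span ⟨i, rfl⟩)
    have h2 : Ideal.span {a} * I₀ = Ideal.span {c'} * (J₀ : Ideal (𝓞 K)) := hac
    rw [h2] at h1
    exact Ideal.mem_span_singleton_mul.mp h1
  choose y hyJ hy using hy
  -- the ideal generated by `y` is `J₀`
  have hspan : Ideal.span (Set.range y) = (J₀ : Ideal (𝓞 K)) := by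
    have hac' : Ideal.span {a} * Ideal.span (Set.range z) = Ideal.span {c'} * (J₀ : Ideal (𝓞 K)) :=
      hac
    have key : Ideal.span {c'} * Ideal.span (Set.range y) = Ideal.span {c'} * (J₀ : Ideal (𝓞 K)) := by
      rw [← hac', Ideal.span_mul_span', Ideal.span_mul_span', Set.singleton_mul,
        Set.singleton_mul, ← Set.range_comp, ← Set.range_comp]
      congr 1
      ext w
      simp only [Set.mem_range, Function.comp_apply]
      constructor
      · rintro ⟨i, rfl⟩; exact ⟨i, (hy i).symm⟩
      · rintro ⟨i, rfl⟩; exact ⟨i, hy i⟩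
    exact (Ideal.span_singleton_mul_right_inj hc').mp key
  -- the scalar `t`
  have hc'K : (c' : K) ≠ 0 := by exact_mod_cast hc'
  refine ⟨(a : K) * (b : 𝓞 K) / c', y, ?_, fun i => ?_, ?_⟩
  · have haK : (a : K) ≠ 0 := by exact_mod_cast ha
    exact div_ne_zero (mul_ne_zero haK hb0) hc'K
  · have hzK : (z i : K) = ((b : 𝓞 K) : K) * x i := by
      rw [hz i, Algebra.smul_def]
    have h1 : (c' : K) * y i = a * (((b : 𝓞 K) : K) * x i) := by
      rw [← hzK]; exact_mod_cast hy i
    field_simp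
    linear_combination h1
  · rw [hspan]
    refine le_trans ?_ (le_max_right _ _)
    exact_mod_cast Finset.le_sup (f := fun c => Ideal.absNorm ((J c : nonZeroDivisors (Ideal (𝓞 K))) :
      Ideal (𝓞 K))) (Finset.mem_univ (ClassGroup.mk0 I₀'))

end ClassGroup

/-! ### Balancing the archimedean absolute values by a unit (Dirichlet) -/

section Units

open NumberField.Units NumberField.Units.dirichletUnitTheorem

variable (K : Type*) [Field K] [NumberField K]

/-- The logarithmic bookkeeping: if `b_w = a_w / (∏ a_w^{m_w})^{1/d}` then `∑_w m_w log b_w = 0`.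
[folklore] -/
theorem sum_mult_mul_log_div_eq_zero (a : InfinitePlace K → ℝ) (ha : ∀ w, 0 < a w) :
    ∑ w : InfinitePlace K, (w.mult : ℝ) *
      Real.log (a w / (∏ w', a w' ^ w'.mult) ^ ((finrank ℚ K : ℝ)⁻¹)) = 0 := by
  set P : ℝ := ∏ w', a w' ^ w'.mult with hP
  have hP0 : 0 < P := Finset.prod_pos fun w _ => pow_pos (ha w) _
  have hd : (0 : ℝ) < finrank ℚ K := by exact_mod_cast Module.finrank_pos
  have hG0 : 0 < P ^ ((finrank ℚ K : ℝ)⁻¹) := Real.rpow_pos_of_pos hP0 _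
  have hlogP : Real.log P = ∑ w', (w'.mult : ℝ) * Real.log (a w') := by
    rw [hP, Real.log_prod (s := Finset.univ) (fun w _ => (pow_pos (ha w) _).ne')]
    simp [Real.log_pow]
  simp_rw [Real.log_div (ha _).ne' hG0.ne', Real.log_rpow hP0, mul_sub, Finset.sum_sub_distrib,
    ← Finset.sum_mul]
  have hsum : ∑ w : InfinitePlace K, (w.mult : ℝ) = finrank ℚ K := by exact_mod_cast sum_mult_eq
  rw [hsum, hlogP]
  field_simp
  ring

/-- **Balancing by units.** There is a constant `C = C_K ≥ 1` such that for every family of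
positive reals `(a_w)_{w ∣ ∞}` there is a unit `u ∈ 𝓞 Kˣ` with
`w(u) a_w ≤ C (∏_w a_w^{m_w})^{1/[K:ℚ]}` for every infinite place `w`: the logarithmic embedding of
the units is a full lattice in the trace-zero hyperplane (Dirichlet's unit theorem, Mathlib
`NumberField.Units.unitLattice`, `instZLattice_unitLattice`), so the vector `(m_w log b_w)_{w ≠ w₀}`,
`b_w = a_w / (∏ a^{m})^{1/d}`, is within a bounded fundamental domain of a lattice point
`(m_w log w(u⁻¹))`. [folklore] -/
theorem exists_unit_mul_le :
    ∃ C : ℝ, 1 ≤ C ∧ ∀ a : InfinitePlace K → ℝ, (∀ w, 0 < a w) →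
      ∃ u : (𝓞 K)ˣ, ∀ w : InfinitePlace K,
        w ((u : 𝓞 K) : K) * a w ≤ C * (∏ w', a w' ^ w'.mult) ^ ((finrank ℚ K : ℝ)⁻¹) := by
  classical
  set B := (basisUnitLattice K).ofZLatticeBasis ℝ (unitLattice K) with hB
  obtain ⟨R₀, hR₀⟩ := (ZSpan.fundamentalDomain_isBounded B).exists_norm_le
  set R := max R₀ 0 with hR
  have hR0 : 0 ≤ R := le_max_right _ _
  have hRF : ∀ f ∈ ZSpan.fundamentalDomain B, ‖f‖ ≤ R := fun f hf => (hR₀ f hf).trans (le_max_left _ _)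
  set N : ℕ := Fintype.card (InfinitePlace K) with hN
  refine ⟨Real.exp (N * R), Real.one_le_exp (by positivity), fun a ha => ?_⟩
  set d : ℕ := finrank ℚ K with hd
  set P : ℝ := ∏ w', a w' ^ w'.mult with hP
  have hP0 : 0 < P := Finset.prod_pos fun w _ => pow_pos (ha w) _
  set G : ℝ := P ^ ((d : ℝ)⁻¹) with hG
  have hG0 : 0 < G := Real.rpow_pos_of_pos hP0 _
  set b : InfinitePlace K → ℝ := fun w => a w / G with hb
  have hb0 : ∀ w, 0 < b w := fun w => div_pos (ha w) hG0
  have hbsum : ∑ w : InfinitePlace K, (w.mult : ℝ) * Real.log (b w) = 0 :=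
    sum_mult_mul_log_div_eq_zero K a ha
  -- the target vector in the log space and the nearby lattice point
  set c : logSpace K := fun w => (w.1.mult : ℝ) * Real.log (b w.1) with hc
  obtain ⟨v, hv, -⟩ := ZSpan.exist_unique_vadd_mem_fundamentalDomain B c
  have hspanB : Submodule.span ℤ (Set.range ⇑B) = unitLattice K :=
    Module.Basis.ofZLatticeBasis_span ℝ (unitLattice K) (basisUnitLattice K)
  have hvL : (v : logSpace K) ∈ unitLattice K := hspanB.le v.2
  obtain ⟨u', -, hu'⟩ := Submodule.mem_map.mp hvL
  set u : (𝓞 K)ˣ := Additive.toMul u' with hu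
  have hvu : (v : logSpace K) = logEmbedding K (Additive.ofMul u) := by
    rw [← hu']; simp [hu]
  set f : logSpace K := (v : logSpace K) + c with hf
  have hfF : f ∈ ZSpan.fundamentalDomain B := hv
  have hfR : ‖f‖ ≤ R := hRF f hfF
  have hupos : ∀ w : InfinitePlace K, 0 < w ((u : 𝓞 K) : K) := fun w => Units.pos_at_place u w
  -- components `f_w = m_w log (w(u) b_w)` for `w ≠ w₀`
  have hfw : ∀ w : {w : InfinitePlace K // w ≠ w₀},
      f w = (w.1.mult : ℝ) * Real.log (w.1 ((u : 𝓞 K) : K) * b w.1) := by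
    intro w
    simp only [hf, Pi.add_apply, hvu, logEmbedding_component, hc]
    rw [Real.log_mul (hupos w.1).ne' (hb0 w.1).ne']
    ring
  have hbound : ∀ w : {w : InfinitePlace K // w ≠ w₀}, |f w| ≤ R := fun w =>
    (norm_le_pi_norm f w).trans hfR
  -- the bound `log (w(u) b_w) ≤ N R` at every place
  have hmain : ∀ w : InfinitePlace K, Real.log (w ((u : 𝓞 K) : K) * b w) ≤ N * R := by
    have hN1 : (1 : ℝ) ≤ N := by
      have : 0 < N := Fintype.card_pos
      exact_mod_cast this
    intro w
    by_cases hw : w = (w₀ : InfinitePlace K)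
    · -- the distinguished place: use the two trace-zero relations
      have h1 : ∑ w' : {w : InfinitePlace K // w ≠ w₀}, f w' =
          -(((w₀ : InfinitePlace K).mult : ℝ) *
            Real.log ((w₀ : InfinitePlace K) ((u : 𝓞 K) : K) * b w₀)) := by
        have hs1 := sum_logEmbedding_component u
        have hs2 : ∑ w' : InfinitePlace K, (w'.mult : ℝ) * Real.log (b w') =
            ((w₀ : InfinitePlace K).mult : ℝ) * Real.log (b w₀) +
              ∑ w' : {w : InfinitePlace K // w ≠ w₀}, (w'.1.mult : ℝ) * Real.log (b w'.1) :=
          Fintype.sum_eq_add_sum_subtype_ne _ w₀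
        rw [hbsum] at hs2
        have hsc : ∑ x : {w : InfinitePlace K // w ≠ w₀}, c x =
            -(((w₀ : InfinitePlace K).mult : ℝ) * Real.log (b w₀)) := by
          simp only [hc]; linarith
        have hsv : ∑ x : {w : InfinitePlace K // w ≠ w₀}, (v : logSpace K) x =
            -(((w₀ : InfinitePlace K).mult : ℝ) * Real.log ((w₀ : InfinitePlace K) ((u : 𝓞 K) : K))) := by
          rw [hvu, hs1, neg_mul]
        calc ∑ w' : {w : InfinitePlace K // w ≠ w₀}, f w'
            = ∑ w' : {w : InfinitePlace K // w ≠ w₀}, ((v : logSpace K) w' + c w') := by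
              simp only [hf, Pi.add_apply]
          _ = ∑ w' : {w : InfinitePlace K // w ≠ w₀}, (v : logSpace K) w' +
                ∑ w' : {w : InfinitePlace K // w ≠ w₀}, c w' := Finset.sum_add_distrib
          _ = _ := by
              rw [hsv, hsc, Real.log_mul (hupos w₀).ne' (hb0 w₀).ne']
              ring
      have h2 : |∑ w' : {w : InfinitePlace K // w ≠ w₀}, f w'| ≤ N * R := by
        calc |∑ w' : {w : InfinitePlace K // w ≠ w₀}, f w'|
            ≤ ∑ w' : {w : InfinitePlace K // w ≠ w₀}, |f w'| := Finset.abs_sum_le_sum_abs _ _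
          _ ≤ ∑ _w' : {w : InfinitePlace K // w ≠ w₀}, R := Finset.sum_le_sum fun w' _ => hbound w'
          _ = (Fintype.card {w : InfinitePlace K // w ≠ w₀}) * R := by simp
          _ ≤ N * R := by
              gcongr
              exact_mod_cast Fintype.card_subtype_le _
      rw [hw]
      have hm : (1 : ℝ) ≤ (w₀ : InfinitePlace K).mult := by exact_mod_cast Nat.one_le_iff_ne_zero.mpr mult_ne_zero
      have h3 : ((w₀ : InfinitePlace K).mult : ℝ) * Real.log ((w₀ : InfinitePlace K) ((u : 𝓞 K) : K) * b w₀) ≤ N * R := by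
        have := (abs_le.mp h2).1
        rw [h1] at this
        linarith
      by_cases hlog : Real.log ((w₀ : InfinitePlace K) ((u : 𝓞 K) : K) * b w₀) ≤ 0
      · exact hlog.trans (by positivity)
      · rw [not_le] at hlog
        nlinarith
    · have h1 := (abs_le.mp (hbound ⟨w, hw⟩)).2
      rw [hfw ⟨w, hw⟩] at h1
      have hm : (1 : ℝ) ≤ w.mult := by exact_mod_cast Nat.one_le_iff_ne_zero.mpr mult_ne_zero
      by_cases hlog : Real.log (w ((u : 𝓞 K) : K) * b w) ≤ 0
      · exact hlog.trans (by positivity)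
      · rw [not_le] at hlog
        nlinarith
  refine ⟨u, fun w => ?_⟩
  have hexp : w ((u : 𝓞 K) : K) * b w ≤ Real.exp (N * R) := by
    have := Real.exp_le_exp.mpr (hmain w)
    rwa [Real.exp_log (mul_pos (hupos w) (hb0 w))] at this
  calc w ((u : 𝓞 K) : K) * a w = (w ((u : 𝓞 K) : K) * b w) * G := by
        simp only [hb]; field_simp
    _ ≤ Real.exp (N * R) * G := by gcongr
    _ = Real.exp (N * R) * P ^ ((d : ℝ)⁻¹) := by rw [hG]

end Units

/-! ### The height zeta function of `ℙ^{n-1}(K)` -/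

section Main

variable (K : Type*) [Field K] [NumberField K] (ι : Type*) [Fintype ι]

/-- **Small balanced integral representatives.** There is `C = C_K ≥ 1` such that every non-zero
`x ∈ K^ι` is proportional to an integral vector `y = t x ∈ (𝓞 K)^ι` with
`‖y‖_∞^{[K:ℚ]} ≤ C · H_K(x)`: clear denominators inside a fixed ideal class
(`exists_integral_rep_absNorm_le`, so that `H_K(x) = H_∞(y₀) / N(⟨y₀⟩) ≥ H_∞(y₀) / C_K`), then
multiply by a unit balancing the archimedean sizes (`exists_unit_mul_le`, so that
`‖u y₀‖_∞ ≤ C_K' H_∞(y₀)^{1/d}`). This is Schanuel's reduction of the count of `ℙ^{n-1}(K)` to a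
lattice-point count (Schanuel 1979; Bombieri–Gubler 11.10.5). [folklore] -/
theorem exists_integral_rep_archSup_pow_le :
    ∃ C : ℝ, 1 ≤ C ∧ ∀ x : ι → K, x ≠ 0 → ∃ (t : K) (y : ι → 𝓞 K), t ≠ 0 ∧
      (∀ i, (y i : K) = t * x i) ∧
      archSup (fun i => (y i : K)) ^ finrank ℚ K ≤ C * Height.mulHeight x := by
  obtain ⟨C₁, hC₁, h₁⟩ := exists_integral_rep_absNorm_le K ι
  obtain ⟨C₂, hC₂, h₂⟩ := exists_unit_mul_le K
  set d : ℕ := finrank ℚ K with hd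
  have hd0 : d ≠ 0 := Module.finrank_pos.ne'
  refine ⟨C₂ ^ d * C₁, one_le_mul_of_one_le_of_one_le (one_le_pow₀ hC₂) hC₁, fun x hx => ?_⟩
  obtain ⟨t, y₀, ht, hy₀, hN⟩ := h₁ x hx
  have hy₀0 : y₀ ≠ 0 := by
    obtain ⟨i, hi⟩ := Function.ne_iff.mp hx
    refine Function.ne_iff.mpr ⟨i, fun h => ?_⟩
    have : (y₀ i : K) = 0 := by simp [h]
    rw [hy₀ i] at this
    exact mul_ne_zero ht hi this
  have hy₀K : (fun i => (y₀ i : K)) ≠ 0 := by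
    obtain ⟨i, hi⟩ := Function.ne_iff.mp hy₀0
    exact Function.ne_iff.mpr ⟨i, by simpa using hi⟩
  -- `H_K(x) = H_∞(y₀) / N ≥ H_∞(y₀) / C₁`
  have hHx : Height.mulHeight x = Height.mulHeight (fun i => (y₀ i : K)) := by
    have : (fun i => (y₀ i : K)) = t • x := funext fun i => by simp [hy₀ i]
    rw [this, Height.mulHeight_smul_eq_mulHeight _ ht]
  have hA := mulHeight_mul_absNorm_eq_archHeight (K := K) hy₀0
  have hNpos : (0 : ℝ) < Ideal.absNorm (Ideal.span (Set.range y₀)) := by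
    have hne : Ideal.absNorm (Ideal.span (Set.range y₀)) ≠ 0 := by
      rw [Ne, Ideal.absNorm_eq_zero_iff, Ideal.span_eq_bot]
      intro h
      obtain ⟨i, hi⟩ := Function.ne_iff.mp hy₀0
      exact hi (h _ ⟨i, rfl⟩)
    exact_mod_cast Nat.pos_of_ne_zero hne
  have hlow : archHeight (fun i => (y₀ i : K)) ≤ C₁ * Height.mulHeight x := by
    rw [hHx, ← hA, mul_comm]
    exact mul_le_mul_of_nonneg_right hN (Height.mulHeight_pos _).le
  -- balance by a unit
  obtain ⟨u, hu⟩ := h₂ (fun w => supAt w fun i => (y₀ i : K)) (fun w => supAt_pos w hy₀K)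
  refine ⟨((u : 𝓞 K) : K) * t, fun i => (u : 𝓞 K) * y₀ i, ?_, fun i => ?_, ?_⟩
  · exact mul_ne_zero (by exact_mod_cast Units.ne_zero u) ht
  · push_cast
    rw [mul_assoc, ← hy₀ i]
  · have hAH : archHeight (fun i => (y₀ i : K)) =
        ∏ w : InfinitePlace K, (supAt w fun i => (y₀ i : K)) ^ w.mult := rfl
    have hG0 : 0 ≤ (archHeight fun i => (y₀ i : K)) ^ ((d : ℝ)⁻¹) :=
      Real.rpow_nonneg (archHeight_nonneg _) _
    have hsup : archSup (fun i => (((u : 𝓞 K) * y₀ i : 𝓞 K) : K)) ≤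
        C₂ * (archHeight fun i => (y₀ i : K)) ^ ((d : ℝ)⁻¹) := by
      refine archSup_le (fun w i => ?_) (by positivity)
      have hsm : (fun i => (((u : 𝓞 K) * y₀ i : 𝓞 K) : K)) = ((u : 𝓞 K) : K) • fun i => (y₀ i : K) :=
        funext fun i => by simp
      calc w ((((u : 𝓞 K) * y₀ i : 𝓞 K) : K))
          ≤ supAt w (fun i => (((u : 𝓞 K) * y₀ i : 𝓞 K) : K)) :=
            le_supAt w (fun i => (((u : 𝓞 K) * y₀ i : 𝓞 K) : K)) i
        _ = w ((u : 𝓞 K) : K) * supAt w (fun i => (y₀ i : K)) := by rw [hsm, supAt_smul]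
        _ ≤ C₂ * (∏ w', (supAt w' fun i => (y₀ i : K)) ^ w'.mult) ^ ((finrank ℚ K : ℝ)⁻¹) := hu w
        _ = C₂ * (archHeight fun i => (y₀ i : K)) ^ ((d : ℝ)⁻¹) := by rw [hAH]
    calc archSup (fun i => (((u : 𝓞 K) * y₀ i : 𝓞 K) : K)) ^ d
        ≤ (C₂ * (archHeight fun i => (y₀ i : K)) ^ ((d : ℝ)⁻¹)) ^ d :=
          pow_le_pow_left₀ (archSup_nonneg _) hsup d
      _ = C₂ ^ d * archHeight (fun i => (y₀ i : K)) := by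
          rw [mul_pow, Real.rpow_inv_natCast_pow (archHeight_nonneg _) hd0]
      _ ≤ C₂ ^ d * (C₁ * Height.mulHeight x) := by gcongr
      _ = C₂ ^ d * C₁ * Height.mulHeight x := by ring

omit [NumberField K] [Fintype ι] in
/-- For an empty index type the projective space is empty. [folklore] -/
theorem isEmpty_projectivization_of_isEmpty [IsEmpty ι] : IsEmpty (ℙ K (ι → K)) :=
  ⟨fun ξ => ξ.rep_nonzero (Subsingleton.elim _ _)⟩

/-- **The height zeta function of `ℙ^{n-1}(K)` converges for `s > n`.** For a number field `K`
and `n = #ι ≥ 1`, `∑_{ξ ∈ ℙ(K^ι)} H_K(ξ)^{-s} < ∞` for every real `s > n`, where `H_K` is the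
relative multiplicative Weil height (Mathlib `Projectivization.mulHeight`, product of
`max_i |x_i|_v` over all places of `K` with the local degrees as multiplicities). This is the
qualitative content of Schanuel's theorem `#{ξ : H_K(ξ) ≤ B} ~ c_{K,n} B^{n}` (Schanuel 1979;
Bombieri–Gubler 11.10.5, who write `T^{nd}` for the absolute height `T = B^{1/d}`). Proof:
`ξ ↦ y_ξ`, a balanced integral representative (`exists_integral_rep_archSup_pow_le`), is injective
and `H_K(ξ)^{-s} ≤ C ∏_i max(1, ‖σ(y_{ξ,i})‖)^{-ds/n}`, a summable function on `(𝓞 K)^ι` since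
`ds/n > d = rank 𝓞 K` (`summable_max_one_norm_rpow_neg`, `summable_pi_prod`).
[cite: BombieriGubler2006, 11.10.5 (Schanuel's theorem)] [cite: Schanuel1979] -/
theorem summable_mulHeight_rpow_neg {s : ℝ} (hs : (Fintype.card ι : ℝ) < s) :
    Summable fun ξ : ℙ K (ι → K) => ξ.mulHeight ^ (-s) := by
  classical
  rcases isEmpty_or_nonempty ι with hι | hι
  · haveI := isEmpty_projectivization_of_isEmpty K ι
    exact summable_empty
  set n : ℕ := Fintype.card ι with hn
  have hn0 : 0 < n := Fintype.card_pos
  have hnR : (0 : ℝ) < n := by exact_mod_cast hn0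
  set d : ℕ := finrank ℚ K with hd
  have hd0 : 0 < d := Module.finrank_pos
  have hdR : (0 : ℝ) < d := by exact_mod_cast hd0
  have hs0 : 0 < s := hnR.trans hs
  set r : ℝ := d * s / n with hr
  have hrd : (finrank ℚ K : ℝ) < r := by
    rw [hr, lt_div_iff₀ hnR]
    calc (finrank ℚ K : ℝ) * n = d * n := by rw [hd]
      _ < d * s := by gcongr
  have hr0 : 0 < r := by positivity
  -- the comparison function on `(𝓞 K)^ι`
  set g : 𝓞 K → ℝ := fun z => (max 1 ‖mixedEmbedding K (z : K)‖) ^ (-r) with hg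
  have hg0 : 0 ≤ g := fun z => Real.rpow_nonneg (by positivity) _
  have hgsum : Summable g := summable_max_one_norm_rpow_neg K hrd
  have hF : Summable fun y : ι → 𝓞 K => ∏ i, g (y i) := summable_pi_prod hg0 hgsum
  -- the representatives
  obtain ⟨C, hC, hrep⟩ := exists_integral_rep_archSup_pow_le K ι
  have hC0 : 0 < C := by linarith
  choose t Y ht hY hle using fun ξ : ℙ K (ι → K) => hrep ξ.rep ξ.rep_nonzero
  have hYmk : ∀ ξ : ℙ K (ι → K), ∀ h, Projectivization.mk K (fun i => (Y ξ i : K)) h = ξ := by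
    intro ξ h
    conv_rhs => rw [← ξ.mk_rep]
    rw [Projectivization.mk_eq_mk_iff]
    refine ⟨Units.mk0 (t ξ) (ht ξ), funext fun i => ?_⟩
    simp [hY ξ i]
  have hY0 : ∀ ξ : ℙ K (ι → K), Y ξ ≠ 0 := by
    intro ξ
    obtain ⟨i, hi⟩ := Function.ne_iff.mp ξ.rep_nonzero
    refine Function.ne_iff.mpr ⟨i, fun h => ?_⟩
    have : (Y ξ i : K) = 0 := by simp [h]
    rw [hY ξ i] at this
    exact mul_ne_zero (ht ξ) hi this
  have hYK : ∀ ξ : ℙ K (ι → K), (fun i => (Y ξ i : K)) ≠ 0 := by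
    intro ξ
    obtain ⟨i, hi⟩ := Function.ne_iff.mp (hY0 ξ)
    exact Function.ne_iff.mpr ⟨i, by simpa using hi⟩
  have hYinj : Function.Injective Y := by
    intro ξ ξ' h
    rw [← hYmk ξ (hYK ξ), ← hYmk ξ' (hYK ξ')]
    congr 1
    exact funext fun i => by rw [h]
  -- pointwise comparison
  have hbound : ∀ ξ : ℙ K (ι → K), ξ.mulHeight ^ (-s) ≤ C ^ s * ∏ i, g (Y ξ i) := by
    intro ξ
    have hH : ξ.mulHeight = Height.mulHeight ξ.rep := by
      have h := Projectivization.mulHeight_mk (K := K) ξ.rep_nonzero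
      rwa [Projectivization.mk_rep] at h
    set A : ℝ := archSup fun i => (Y ξ i : K) with hA
    have hA1 : 1 ≤ A := one_le_archSup (hY0 ξ)
    have hA0 : 0 < A := by linarith
    have hle' : A ^ d / C ≤ Height.mulHeight ξ.rep := by
      rw [div_le_iff₀ hC0, mul_comm]; exact hle ξ
    -- `H^{-s} ≤ (A^d / C)^{-s} = C^s A^{-ds}`
    have h1 : ξ.mulHeight ^ (-s) ≤ (A ^ d / C) ^ (-s) := by
      rw [hH]
      exact Real.rpow_le_rpow_of_nonpos (by positivity) hle' (by linarith)
    have h2 : (A ^ d / C) ^ (-s) = C ^ s * A ^ (-(r * n)) := by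
      have hrn : r * n = d * s := by rw [hr]; field_simp
      rw [Real.div_rpow (by positivity) hC0.le, Real.rpow_neg hC0.le, hrn, div_eq_mul_inv, inv_inv,
        mul_comm, ← Real.rpow_natCast A d, ← Real.rpow_mul hA0.le, neg_mul_eq_mul_neg]
    -- `A^{-rn} = ∏_i A^{-r} ≤ ∏_i g(y_i)`
    have h3 : A ^ (-(r * n)) ≤ ∏ i, g (Y ξ i) := by
      have hprod : ∏ _i : ι, A ^ (-r) = A ^ (-(r * n)) := by
        rw [Finset.prod_const, Finset.card_univ, ← hn, ← Real.rpow_mul_natCast hA0.le, neg_mul]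
      rw [← hprod]
      refine Finset.prod_le_prod (fun i _ => Real.rpow_nonneg hA0.le _) fun i _ => ?_
      have hgi : max 1 ‖mixedEmbedding K (Y ξ i : K)‖ ≤ A :=
        max_le hA1 (norm_mixedEmbedding_le_archSup (fun i => (Y ξ i : K)) i)
      exact Real.rpow_le_rpow_of_nonpos (by positivity) hgi (by linarith)
    calc ξ.mulHeight ^ (-s) ≤ (A ^ d / C) ^ (-s) := h1
      _ = C ^ s * A ^ (-(r * n)) := h2
      _ ≤ C ^ s * ∏ i, g (Y ξ i) := by gcongr
  refine Summable.of_nonneg_of_le (fun ξ => Real.rpow_nonneg ξ.mulHeight_pos.le _) hbound ?_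
  exact (hF.comp_injective hYinj).mul_left (C ^ s)

/-- **Northcott's theorem for `ℙ^{n-1}(K)`.** Over a number field there are only finitely many
points of `ℙ(K^ι)` of bounded height (Northcott 1949; Bombieri–Gubler, Thm. 2.4.9, the case of
`K`-rational points; a `TODO` of Mathlib's `NumberTheory.Height.Northcott`). Here from the
convergence of the height zeta function: its terms tend to `0` along the cofinite filter.
[cite: BombieriGubler2006, Thm. 2.4.9] -/
theorem finite_setOf_mulHeight_le (B : ℝ) : {ξ : ℙ K (ι → K) | ξ.mulHeight ≤ B}.Finite := by
  set B' := max B 1 with hB'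
  have hB'0 : 0 < B' := lt_of_lt_of_le one_pos (le_max_right _ _)
  set s : ℝ := Fintype.card ι + 1 with hs
  have hsum := summable_mulHeight_rpow_neg K ι (s := s) (by rw [hs]; linarith)
  have hev := hsum.tendsto_cofinite_zero.eventually (gt_mem_nhds (Real.rpow_pos_of_pos hB'0 (-s)))
  refine (Filter.eventually_cofinite.mp hev).subset fun ξ hξ => ?_
  simp only [Set.mem_setOf_eq, not_lt] at hξ ⊢
  have hξ' : ξ.mulHeight ≤ B' := hξ.trans (le_max_left _ _)
  exact Real.rpow_le_rpow_of_nonpos ξ.mulHeight_pos hξ' (by rw [hs]; linarith [(Nat.cast_nonneg _ : (0:ℝ) ≤ Fintype.card ι)])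

end Main

end ProjectiveHeight

end Literature.NumberTheory.DiophantineGeometry
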